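import Literature.AlgebraicGeometry.Resolution.AlterationsStableModel
import Literature.AlgebraicGeometry.Resolution.AlterationsModification
import HarnessLib

/-!
# De Jong's alteration theorem: 4.18–4.22a split where `β` has been extended — 4.22a PROVED

Topic: `Literature/AlgebraicGeometry/Resolution`. Companion to `AlterationsStableModel.lean`,
which vendors de Jong 1996, 4.18–4.21 with the first half of 4.22 — from a fibred pair `(X, Z)`
with (i), (iii), (iv), (vi) a)–g) (`DeJong1996.FibredPair`, `DeJong1996.HasThreeSmoothPoints`,
`DeJong1996.IsUnionOfSectionsWithModel`) to the pointed semi-stable curve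
`(𝒞, τ₁(Y) ∪ … ∪ τₙ(Y) ∪ f⁻¹(D))` (`DeJong1996.PreSemiStablePair`) — as ONE named fact
`DeJong1996StableModelToPreSemiStablePair`. This file cuts it inside 4.22, after

> "4.22. We continue the discussion of the proof of Theorem 4.1, from the point we left it in
> the beginning of 4.18. Thus we have a pair `(X, Z)` satisfying (i)–(iv), (vi) a)–g). We apply
> the results of 4.18–4.21 and find a modification `ψ : Y' → Y`, such that `β'` extends. Once
> again using 4.15 we may replace `Y` by `Y'`, etc., and assume that `β` extends to
> `β : 𝒞 → X` and we still have (i)–(iv), (vi) a)–g)." (p. 74)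

and PROVES the rest of 4.22 up to the induction hypothesis:

> "Consider the closed subset `β⁻¹(Z)`, which is pure of codimension 1 in `𝒞` by (iv). Let `E'`
> be an irreducible component of `β⁻¹(Z)`. If we do not have `E' = τᵢ(Y)` for some `i`, then the
> image `D'` of `E'` in `Y` has codimension 1 in `Y`, as `β` is an isomorphism over the open
> set `U` of (vi) g). Thus there is a closed subset `D ⊂ Y` such that we have
> `β⁻¹(Z) ⊂ τ₁(Y) ∪ … ∪ τₙ(Y) ∪ f⁻¹(D)` and such that `𝒞 → Y` is smooth over `Y ∖ D`. We
> replace `X` by `𝒞` and `Z` by `τ₁(Y) ∪ … ∪ τₙ(Y) ∪ f⁻¹(D)`, see 4.4 and 4.9." (p. 74)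

Accordingly this file

* defines **(vi) g) with `β` extended**, `DeJong1996.HasExtendedPointedSemiStableModel f g σ`:
  an integral `𝒞`, projective over `k`, a pointed semi-stable curve `(p : 𝒞 → Y, τ₁, …, τₙ)`
  (`DeJong1996.IsPointedSemiStableCurve`), a MORPHISM `β : 𝒞 → X` over `Y` (`β ≫ f = p`) with
  `β ∘ τᵢ = σᵢ`, and a non-empty open `U ⊆ Y` over which `f` is smooth and `β` is an
  isomorphism (`IsIso (β ∣_ f⁻¹(U))`); and its conjunction with (vi) f) sharing the `σᵢ`,
  `DeJong1996.IsUnionOfSectionsWithExtendedModel f g Z`; proved API: an extended model is a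
  model in the sense of (vi) g) (`….hasPointedSemiStableModel`, restricting `β` over `U`), and
  non-vacuity (the curve of a pre-semi-stable pair, `β = 𝟙`, `U = Y ∖ D`);
* PROVES **4.22a** (`DeJong1996.FibredPair.conclusionGenericallyEtale_of_extendedModel`): for a
  fibred pair with (vi) f) + g)-extended, Thm. 4.1 with its generically-étale clause follows from
  the same for all pre-semi-stable pairs over `k` of the same dimension. The printed codimension
  count is replaced by the elementary choice `D = Y ∖ U`: `β` is proper (`p` is, `f` is
  separated) and birational (an isomorphism over the dense open `f⁻¹(U)`), hence a generically
  étale alteration, so 4.4 applies (`ConclusionGenericallyEtale.of_isBirational_of_conclusion`)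
  and `dim 𝒞 = dim X` (2.20); `β⁻¹(Z)` is the support of the pulled-back Cartier divisor of
  (iv) (`IsEffectiveCartier.comap_of_isDominant`) and lies in `⋃ᵢ τᵢ(Y) ∪ p⁻¹(Y ∖ U)` — over
  `U`, a point `c` with `β(c) = σᵢ(y) = β(τᵢ(y))` equals `τᵢ(y)` by injectivity of `β` on
  `p⁻¹(U)` — so 4.9 applies (`ConclusionGenericallyEtale.of_subset`); and
  `(𝒞 → Y, D = Y ∖ U, τ)` is a pre-semi-stable pair: `p` is smooth over `U` because
  `p|_U = β|_U ≫ f|_U` with `β|_U` an isomorphism and `f` smooth over `U`;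
* vendors the remaining part as the NAMED FACT `DeJong1996ModelExtensionReduction` (**4.18–4.21
  with the first two sentences of 4.22**: Thm. 4.1 with the clause for a fibred pair with
  (vi) e), f), g) follows from the same for all fibred pairs over `k` with (vi) e), f) and
  g)-extended of the same dimension — the three-point lemma producing the modification
  `ψ : Y' → Y` over which `β'` extends, and the replacement of `Y` by `Y'` as in 4.15);
* PROVES the assembly `DeJong1996StableModelToPreSemiStablePair.of_extensionReduction`, the
  composite `DeJong1996SectionsToPreSemiStablePair.of_stableModel_of_extensionReduction`, and the
  sanity implication from `DeJong1996StrongAlgClosed`.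

On smoothness over `U`: the landed rendering of (vi) g) (`DeJong1996.HasPointedSemiStableModel`)
does not record that `f` is smooth over `U`, while 4.17 defines
"`U = {y ∈ Y | X_y is smooth over y and …}`" and 4.22 uses it ("such that `𝒞 → Y` is smooth over
`Y ∖ D`"); the extended form records it, so the prover of `DeJong1996ModelExtensionReduction`
must also shrink `U` into the locus over which `f` is smooth (non-empty by (vi) c), the generic
fibre being smooth and `f` proper). `DeJong1996ModelExtensionReduction` is the node to decompose
further (the three-point lemma in the general setting of 4.18–4.21: strict transforms 2.18,
flattening 2.19, Lemma 4.20, Serre's criterion 4.21; and 4.15 along a modification).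

## Sources

* A. J. de Jong, *Smoothness, semi-stability and alterations*, Publ. Math. IHÉS 83 (1996) 51–93:
  2.17–2.20 (pp. 59–61), Thm. 4.1, 4.4, 4.9 (pp. 66–67), 4.15, 4.17 (pp. 71–72), 4.18–4.22
  (pp. 72–74).
-/

noncomputable section

open CategoryTheory CategoryTheory.Limits AlgebraicGeometry TopologicalSpace Topology

namespace Literature.AlgebraicGeometry.Resolution

universe u

namespace DeJong1996

/-! ## (vi) g) with `β` extended -/

/-- **de Jong 1996, 4.22: "(vi) g) and `β` extends to `β : 𝒞 → X`"** for `f : X → Y` over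
`g : Y → Spec k` and sections `σ₁, …, σₙ` of `f` ("We apply the results of 4.18–4.21 and find a
modification `ψ : Y' → Y`, such that `β'` extends. Once again using 4.15 we may replace `Y` by
`Y'`, etc., and assume that `β` extends to `β : 𝒞 → X` and we still have (i)–(iv),
(vi) a)–g)"). Rendered as `HasPointedSemiStableModel` with the isomorphism `β : 𝒞_U ⥲ X_U`
replaced by a morphism defined on all of `𝒞`: there are an integral scheme `𝒞`, projective over
`k`, a pointed semi-stable curve `(p : 𝒞 → Y, τ₁, …, τₙ)` (`IsPointedSemiStableCurve`), a
non-empty open `U ⊆ Y` over which `f` is smooth (4.17: "`U = {y ∈ Y | X_y is smooth over y and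
σᵢ(y) ≠ σⱼ(y) for i ≠ j}`"), and a morphism `β : 𝒞 → X` over `Y` (`β ≫ f = p`) which is an
isomorphism over `U` (`β|_{f⁻¹(U)} : p⁻¹(U) ⥲ f⁻¹(U)`) and maps the section `τᵢ` to the section
`σᵢ` (`τᵢ ≫ β = σᵢ`). [cite: DeJong1996, 4.22, p. 74] -/
def HasExtendedPointedSemiStableModel {k : Type u} [Field k] {X Y : Scheme.{u}} (f : X ⟶ Y)
    (g : Y ⟶ Spec (.of k)) {n : ℕ} (σ : Fin n → (Y ⟶ X)) : Prop :=
  ∃ (C : Scheme.{u}) (p : C ⟶ Y) (τ : Fin n → (Y ⟶ C)) (U : Y.Opens) (β : C ⟶ X),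
    IsIntegral C ∧ Literature.AlgebraicGeometry.Motives.IsProjectiveOver (Over.mk (p ≫ g)) ∧
      IsPointedSemiStableCurve p τ ∧ (U : Set Y).Nonempty ∧ Smooth (f ∣_ U) ∧ β ≫ f = p ∧
        IsIso (β ∣_ f ⁻¹ᵁ U) ∧ ∀ i, τ i ≫ β = σ i

namespace HasExtendedPointedSemiStableModel

variable {k : Type u} [Field k] {X Y : Scheme.{u}} {f : X ⟶ Y} {g : Y ⟶ Spec (.of k)}

/-- **An extended model is a model in the sense of (vi) g)**: restrict `β` over `U`. The
isomorphism is `p⁻¹(U) = β⁻¹(f⁻¹(U)) ⥲ f⁻¹(U)`, it lies over `Y`, and the corestriction `t` of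
`τᵢ|_U` to `p⁻¹(U)` is carried to `σᵢ|_U` because `τᵢ ≫ β = σᵢ`. [folklore] -/
theorem hasPointedSemiStableModel {n : ℕ} {σ : Fin n → (Y ⟶ X)}
    (h : HasExtendedPointedSemiStableModel f g σ) : HasPointedSemiStableModel f g σ := by
  obtain ⟨C, p, τ, U, β, hC, hproj, hpt, hU, -, hβf, hiso, hτβ⟩ := h
  haveI := hiso
  have heq : p ⁻¹ᵁ U = β ⁻¹ᵁ (f ⁻¹ᵁ U) := by rw [← hβf, Scheme.Hom.comp_preimage]
  refine ⟨C, p, τ, U, (C.isoOfEq heq).hom ≫ β ∣_ f ⁻¹ᵁ U, hC, hproj, hpt, hU, inferInstance,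
    ?_, fun i => ?_⟩
  · rw [Category.assoc, morphismRestrict_ι_assoc, hβf, Scheme.isoOfEq_hom_ι_assoc]
  · have hsub : Set.range (U.ι ≫ τ i) ⊆ Set.range (p ⁻¹ᵁ U).ι := by
      rintro _ ⟨y, rfl⟩
      rw [Scheme.Opens.range_ι]
      show p (τ i (U.ι y)) ∈ U
      rw [← Scheme.Hom.comp_apply, hpt.comp_eq_id i]
      simp
    refine ⟨IsOpenImmersion.lift (p ⁻¹ᵁ U).ι (U.ι ≫ τ i) hsub, IsOpenImmersion.lift_fac _ _ _, ?_⟩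
    simp only [Category.assoc, morphismRestrict_ι, Scheme.isoOfEq_hom_ι_assoc,
      IsOpenImmersion.lift_fac_assoc, hτβ]

/-- **Non-vacuity: the curve of a pre-semi-stable pair is an extended model of itself**
(`𝒞 = X`, `β = 𝟙`, `U = Y ∖ D`, over which `f` is smooth). [folklore] -/
theorem _root_.Literature.AlgebraicGeometry.Resolution.DeJong1996.PreSemiStablePair.hasExtendedPointedSemiStableModel
    {D : Set Y} {n : ℕ} {τ : Fin n → (Y ⟶ X)} (h : PreSemiStablePair f g D τ) :
    HasExtendedPointedSemiStableModel f g τ := by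
  haveI := h.isIntegral
  haveI := h.smooth_morphismRestrict
  obtain ⟨y, hy⟩ := (Set.ne_univ_iff_exists_notMem D).mp h.ne_univ
  exact ⟨X, f, τ, ⟨Dᶜ, h.isClosed.isOpen_compl⟩, 𝟙 X, inferInstance, h.isProjectiveOver,
    h.isPointedSemiStableCurve, ⟨y, hy⟩, inferInstance, Category.id_comp _, inferInstance,
    fun i => Category.comp_id _⟩

end HasExtendedPointedSemiStableModel

/-- **(vi) f) and "(vi) g), `β` extends" together** (de Jong 1996, 4.22) for `f : X → Y` over
`g : Y → Spec k` and `Z ⊆ X`: pairwise distinct sections `σ₁, …, σₙ` of `f` with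
`Z = ⋃ᵢ σᵢ(Y)` ((vi) f)) admitting an extended pointed semi-stable model
(`HasExtendedPointedSemiStableModel f g σ`). [cite: DeJong1996, 4.22, p. 74] -/
def IsUnionOfSectionsWithExtendedModel {k : Type u} [Field k] {X Y : Scheme.{u}} (f : X ⟶ Y)
    (g : Y ⟶ Spec (.of k)) (Z : Set X) : Prop :=
  ∃ (n : ℕ) (σ : Fin n → (Y ⟶ X)), Function.Injective σ ∧ (∀ i, σ i ≫ f = 𝟙 Y) ∧
    HasExtendedPointedSemiStableModel f g σ ∧ Z = ⋃ i, Set.range (σ i)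

namespace IsUnionOfSectionsWithExtendedModel

variable {k : Type u} [Field k] {X Y : Scheme.{u}} {f : X ⟶ Y} {g : Y ⟶ Spec (.of k)}
  {Z : Set X}

/-- (vi) f) + g)-extended gives (vi) f) + g). [folklore] -/
theorem isUnionOfSectionsWithModel (h : IsUnionOfSectionsWithExtendedModel f g Z) :
    IsUnionOfSectionsWithModel f g Z := by
  obtain ⟨n, σ, hinj, hσ, hmod, hZ⟩ := h
  exact ⟨n, σ, hinj, hσ, hmod.hasPointedSemiStableModel, hZ⟩

/-- (vi) f) + g)-extended gives (vi) f). [folklore] -/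
theorem isUnionOfSections (h : IsUnionOfSectionsWithExtendedModel f g Z) :
    IsUnionOfSections f Z :=
  h.isUnionOfSectionsWithModel.isUnionOfSections

/-- (vi) f) + g)-extended from its parts with shared sections. [folklore] -/
theorem mk' {n : ℕ} {σ : Fin n → (Y ⟶ X)} (hinj : Function.Injective σ)
    (hσ : ∀ i, σ i ≫ f = 𝟙 Y) (hZ : Z = ⋃ i, Set.range (σ i))
    (hmod : HasExtendedPointedSemiStableModel f g σ) : IsUnionOfSectionsWithExtendedModel f g Z :=
  ⟨n, σ, hinj, hσ, hmod, hZ⟩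

end IsUnionOfSectionsWithExtendedModel

/-- A pre-semi-stable pair with empty `D` has (vi) f) + g)-extended for its own boundary
`Z = ⋃ᵢ τᵢ(Y)`. [folklore] -/
theorem PreSemiStablePair.isUnionOfSectionsWithExtendedModel {k : Type u} [Field k]
    {X Y : Scheme.{u}} {f : X ⟶ Y} {g : Y ⟶ Spec (.of k)} {n : ℕ} {τ : Fin n → (Y ⟶ X)}
    (h : PreSemiStablePair f g ∅ τ) :
    IsUnionOfSectionsWithExtendedModel f g (semiStableBoundary f ∅ τ) := by
  haveI := h.isIntegral_base
  refine IsUnionOfSectionsWithExtendedModel.mk' h.isPointedSemiStableCurve.injective h.comp_eq_id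
    ?_ h.hasExtendedPointedSemiStableModel
  simp [semiStableBoundary]

/-! ## 4.22a, proved -/

/-- **de Jong 1996, 4.22 up to the induction hypothesis, given the extended `β`.** Let `(X, Z)`
with `f : X → Y → Spec k` satisfy (i), (iii), (iv), (vi) a)–d) (`FibredPair f g Z`) and (vi) f)
with an extended pointed semi-stable model `(p : 𝒞 → Y, τ, β : 𝒞 → X, U)`
(`IsUnionOfSectionsWithExtendedModel f g Z`). If Thm. 4.1 with its generically-étale clause
holds for every pre-semi-stable pair over `k` of dimension `dim X`, it holds for
`(X → Spec k, Z)`: "Thus there is a closed subset `D ⊂ Y` such that we have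
`β⁻¹(Z) ⊂ τ₁(Y) ∪ … ∪ τₙ(Y) ∪ f⁻¹(D)` and such that `𝒞 → Y` is smooth over `Y ∖ D`. We replace
`X` by `𝒞` and `Z` by `τ₁(Y) ∪ … ∪ τₙ(Y) ∪ f⁻¹(D)`, see 4.4 and 4.9." Here `D = Y ∖ U`; `β` is a
proper birational morphism, i.e. a generically étale alteration (4.4,
`ConclusionGenericallyEtale.of_isBirational_of_conclusion`; `dim 𝒞 = dim X`, 2.20); `β⁻¹(Z)` is
the support of the pulled-back divisor of (iv) and is contained in the boundary (4.9,
`ConclusionGenericallyEtale.of_subset`); and `(𝒞, ⋃ᵢ τᵢ(Y) ∪ p⁻¹(D))` is a pre-semi-stable pair.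
Hypothesis (vi) e) is not needed for this step. [cite: DeJong1996, 4.22, p. 74] -/
theorem FibredPair.conclusionGenericallyEtale_of_extendedModel {k : Type u} [Field k]
    {X Y : Scheme.{u}} [IsIntegral Y] {f : X ⟶ Y} {g : Y ⟶ Spec (.of k)} {Z : Set X}
    (hP : FibredPair f g Z) (hZ : IsUnionOfSectionsWithExtendedModel f g Z)
    (hS : ∀ (X' Y' : Scheme.{u}) (f' : X' ⟶ Y') (g' : Y' ⟶ Spec (.of k)) (D' : Set Y') (n : ℕ)
      (τ : Fin n → (Y' ⟶ X')), PreSemiStablePair f' g' D' τ →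
        topologicalKrullDim X' = topologicalKrullDim X →
          ConclusionGenericallyEtale (f' ≫ g') (semiStableBoundary f' D' τ)) :
    ConclusionGenericallyEtale (f ≫ g) Z := by
  obtain ⟨n, σ, -, -, ⟨C, p, τ, U, β, hC, hproj, hpt, hUne, hUsm, hβf, hiso, hτβ⟩, hZσ⟩ := hZ
  haveI := hP.isIntegral
  haveI := hC
  haveI := hUsm
  haveI := hiso
  haveI : IsProper (f ≫ g) := hP.isProper
  haveI : IsSeparated (f ≫ g) := hP.isSeparated
  haveI : LocallyOfFiniteType (f ≫ g) := hP.locallyOfFiniteType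
  haveI : IsSeparated f := IsSeparated.of_comp f g
  haveI : IsProper p := hpt.isSemiStableCurve.isProper
  haveI : IsProper (β ≫ f) := by rw [hβf]; infer_instance
  haveI : IsProper β := IsProper.of_comp β f
  have hpβ : ∀ c : C, p c = f (β c) := fun c => by rw [← hβf, Scheme.Hom.comp_apply]
  -- `β` is birational: an isomorphism over the dense open `f⁻¹(U)` with dense preimage `p⁻¹(U)`
  have hbir : IsBirational β := by
    refine ⟨f ⁻¹ᵁ U, ?_, ?_, hiso⟩
    · obtain ⟨y, hy⟩ := hUne
      obtain ⟨x, rfl⟩ := hP.isCurveFibration.surjective.surj y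
      exact (f ⁻¹ᵁ U).isOpen.dense ⟨x, hy⟩
    · haveI : IsDominant p := hpt.isSemiStableCurve.isDominant
      obtain ⟨c, hc⟩ := p.denseRange.exists_mem_open U.isOpen hUne
      refine (β ⁻¹ᵁ (f ⁻¹ᵁ U)).isOpen.dense ⟨c, ?_⟩
      show f (β c) ∈ U
      rwa [← hpβ]
  haveI : IsDominant β := hbir.isDominant
  -- 4.4 along the modification `β`
  refine ConclusionGenericallyEtale.of_isBirational_of_conclusion hbir ?_
  -- 4.9: enlarge `β⁻¹(Z)` to the boundary `⋃ᵢ τᵢ(Y) ∪ p⁻¹(Y ∖ U)`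
  set D : Set Y := (U : Set Y)ᶜ with hD
  have hsub : β ⁻¹' Z ⊆ semiStableBoundary p D τ := by
    intro c hc
    rw [mem_semiStableBoundary_iff]
    by_cases hcU : p c ∈ (U : Set Y)
    · left
      rw [Set.mem_preimage, hZσ, Set.mem_iUnion] at hc
      obtain ⟨i, y, hy⟩ := hc
      refine ⟨i, y, ?_⟩
      have h1 : β (τ i y) = β c := by rw [← Scheme.Hom.comp_apply, hτβ]; exact hy
      have hcW : c ∈ β ⁻¹ᵁ (f ⁻¹ᵁ U) := by
        show f (β c) ∈ U
        rwa [← hpβ]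
      have hτW : τ i y ∈ β ⁻¹ᵁ (f ⁻¹ᵁ U) := by
        show f (β (τ i y)) ∈ U
        rw [h1, ← hpβ]
        exact hcU
      have hinj := (β ∣_ f ⁻¹ᵁ U).isOpenEmbedding.injective
      have key : (⟨τ i y, hτW⟩ : β ⁻¹ᵁ (f ⁻¹ᵁ U)) = ⟨c, hcW⟩ :=
        hinj (Subtype.ext (by rw [morphismRestrict_base_coe, morphismRestrict_base_coe]; exact h1))
      exact congrArg Subtype.val key
    · right
      exact hcU
  have hcart : ∃ I : C.IdealSheafData, IsEffectiveCartier I ∧ (I.support : Set C) = β ⁻¹' Z := by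
    obtain ⟨I, hI, hIZ⟩ := hP.exists_isEffectiveCartier
    refine ⟨I.comap β, hI.comap_of_isDominant β, ?_⟩
    rw [Scheme.IdealSheafData.support_comap, TopologicalSpace.Closeds.coe_preimage, hIZ]
  refine ConclusionGenericallyEtale.of_subset hsub hcart ?_
  -- the new pair `(𝒞, ⋃ᵢ τᵢ(Y) ∪ p⁻¹(D))` is a pre-semi-stable pair of dimension `dim X`
  have hcomp : β ≫ f ≫ g = p ≫ g := by rw [← Category.assoc, hβf]
  rw [hcomp]
  have hsmU : Smooth (p ∣_ U) := by
    have h1 : Smooth (β ∣_ f ⁻¹ᵁ U ≫ f ∣_ U) := inferInstance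
    rw [← morphismRestrict_comp] at h1
    rw [← hβf]
    exact h1
  have hsm : ∀ V : Y.Opens, V = U → Smooth (p ∣_ V) := by
    rintro V rfl
    exact hsmU
  refine hS C Y p g D n τ
    { isIntegral := hC
      isProjectiveOver := hproj
      isIntegral_base := ‹_›
      isProjectiveOver_base := hP.isProjectiveOver_base
      isClosed := U.isOpen.isClosed_compl
      ne_univ := fun huniv => ?_
      isSemiStableCurve := hpt.isSemiStableCurve
      smooth_morphismRestrict := hsm _ (TopologicalSpace.Opens.ext (compl_compl _))
      comp_eq_id := hpt.comp_eq_id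
      pairwise_disjoint := hpt.pairwise_disjoint
      exists_smooth := hpt.exists_smooth } ?_
  · obtain ⟨y, hy⟩ := hUne
    have : y ∈ D := huniv ▸ Set.mem_univ y
    exact this hy
  · exact IsAlteration.topologicalKrullDim_eq (f ≫ g) hbir.isAlteration

end DeJong1996

/-! ## 4.18–4.21 with the first sentences of 4.22 as a named fact -/

/-- NAMED FACT — **de Jong 1996, 4.18–4.21 and the first two sentences of 4.22: extending `β`
after a modification of the base.** Over an algebraically closed field `k`, let `(X, Z)` with
`f : X → Y → Spec k` satisfy (i), (iii), (iv), (vi) a)–d) (`DeJong1996.FibredPair f g Z`), (vi) e)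
(`DeJong1996.HasThreeSmoothPoints f Z`) and (vi) f) + g) (`DeJong1996.IsUnionOfSectionsWithModel
f g Z`). Then Thm. 4.1 with its generically-étale clause for `(X → Spec k, Z)` follows from
Thm. 4.1 with the clause for every such pair `(X', Z')` with `f' : X' → Y' → Spec k` over `k`
which has (vi) e), (vi) f) and (vi) g) WITH `β` EXTENDED
(`DeJong1996.IsUnionOfSectionsWithExtendedModel f' g' Z'`: a pointed semi-stable model
`(p : 𝒞 → Y', τ)` with a morphism `β : 𝒞 → X'` over `Y'`, `β ∘ τᵢ = σᵢ`, an isomorphism over a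
non-empty open `U ⊆ Y'` over which `f'` is smooth) and `dim X' = dim X`. This is 4.18–4.21 in
the general setting of 4.18 — "Suppose we are given a proper morphism `f : X → S` of integral
excellent schemes, with sections `σ₁, …, σₙ` satisfying […] a) […] b) […] c) […] e) […] g)
[…]. Let us define `T` as the closure of `Γ_β` in the scheme `𝒞 ×_S X`. […] by [22], see 2.19,
we may assume […] h) Both `X` and `T` […] are flat over `S`. […] i) The scheme `S` is normal.
[…] 4.20. Lemma. […] 4.21. […] Thus the birational finite morphism `pr₁ : T → 𝒞` is an
isomorphism. We conclude that the properties a)–c), e) and g) […] imply that the rational map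
`β` extends to a birational morphism `β : 𝒞 → X`, at least after replacing `S` by a
modification and `𝒞` and `X` by their strict transforms." — followed by 4.22: "We apply the
results of 4.18–4.21 and find a modification `ψ : Y' → Y`, such that `β'` extends. Once again
using 4.15 we may replace `Y` by `Y'`, etc., and assume that `β` extends to `β : 𝒞 → X` and we
still have (i)–(iv), (vi) a)–g)." The replacement is along the strict transform
`φ : X' → X` of the modification `ψ` (4.15; a modification is a generically étale alteration,
2.17/2.20; 4.4, `DeJong1996.ConclusionGenericallyEtale.of_isAlteration`), which preserves
`dim X`; the open `U` is shrunk into `ψ⁻¹` of the locus over which `f` is smooth (non-empty by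
(vi) c): the generic fibre is smooth and `f` is proper; cf. the definition of `U` in 4.17).
Of "stable `n`-pointed" only nodality, distinctness of the labelled points and their lying in
the smooth locus are used (4.20, 4.21), so the printed argument proves the statement with the
pointed semi-stable rendering of (vi) g). Users take `(h : DeJong1996ModelExtensionReduction)`;
it is the node to decompose further (strict transforms 2.18, flattening 2.19, the three-point
Lemma 4.20, Serre's criterion 4.21, and 4.15 along a modification).
[cite: DeJong1996, 4.18–4.22, pp. 72–74] -/
def DeJong1996ModelExtensionReduction : Prop :=
  ∀ (k : Type u) [Field k] [IsAlgClosed k] (X Y : Scheme.{u}) [IsIntegral Y] (f : X ⟶ Y)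
    [LocallyOfFinitePresentation f] (g : Y ⟶ Spec (.of k)) (Z : Set X),
    DeJong1996.FibredPair f g Z → DeJong1996.HasThreeSmoothPoints f Z →
      DeJong1996.IsUnionOfSectionsWithModel f g Z →
        (∀ (X' Y' : Scheme.{u}) [IsIntegral Y'] (f' : X' ⟶ Y') [LocallyOfFinitePresentation f']
            (g' : Y' ⟶ Spec (.of k)) (Z' : Set X'),
            DeJong1996.FibredPair f' g' Z' → DeJong1996.HasThreeSmoothPoints f' Z' →
              DeJong1996.IsUnionOfSectionsWithExtendedModel f' g' Z' →
                topologicalKrullDim X' = topologicalKrullDim X →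
                  DeJong1996.ConclusionGenericallyEtale (f' ≫ g') Z') →
          DeJong1996.ConclusionGenericallyEtale (f ≫ g) Z

/-! ## The assembly -/

/-- **4.18–4.22a (`DeJong1996StableModelToPreSemiStablePair`) from 4.18–4.21 with the first
sentences of 4.22 (`DeJong1996ModelExtensionReduction`) and the proved remainder of 4.22a
(`DeJong1996.FibredPair.conclusionGenericallyEtale_of_extendedModel`).**
[cite: DeJong1996, 4.18–4.22, pp. 72–74] -/
theorem DeJong1996StableModelToPreSemiStablePair.of_extensionReduction
    (h : DeJong1996ModelExtensionReduction.{u}) : DeJong1996StableModelToPreSemiStablePair.{u} := by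
  intro k _ _ X Y _ f _ g Z hP h3 hfg hS
  refine h k X Y f g Z hP h3 hfg ?_
  intro X' Y' _ f' _ g' Z' hP' _ hext hdim'
  exact hP'.conclusionGenericallyEtale_of_extendedModel hext
    fun X'' Y'' f'' g'' D'' n τ hpre hdim'' => hS X'' Y'' f'' g'' D'' n τ hpre (hdim''.trans hdim')

/-- **4.17–4.22a (`DeJong1996SectionsToPreSemiStablePair`) from 4.17
(`DeJong1996StableModelReduction`) and 4.18–4.21/4.22 (`DeJong1996ModelExtensionReduction`).**
[cite: DeJong1996, 4.17–4.22, pp. 71–74] -/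
theorem DeJong1996SectionsToPreSemiStablePair.of_stableModel_of_extensionReduction
    (h₁ : DeJong1996StableModelReduction.{u}) (h₂ : DeJong1996ModelExtensionReduction.{u}) :
    DeJong1996SectionsToPreSemiStablePair.{u} :=
  DeJong1996SectionsToPreSemiStablePair.of_stableModel_of_toPre h₁
    (DeJong1996StableModelToPreSemiStablePair.of_extensionReduction h₂)

/-- **Thm. 4.1 with its generically-étale clause over algebraically closed fields
(`DeJong1996StrongAlgClosed`) from the seven live nodes** 4.11–4.12, 4.14, 4.15–4.16, 4.17,
4.18–4.21/4.22, 4.22b, 4.23–4.28. [cite: DeJong1996, 4.3–4.28, pp. 66–76] -/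
theorem DeJong1996StrongAlgClosed.of_sevenBlocks' (h₀ : DeJong1996FibrationReduction.{u})
    (h14 : DeJong1996MultisectionReduction.{u}) (hS : DeJong1996SectionsReduction.{u})
    (h₁ : DeJong1996StableModelReduction.{u}) (h₂ : DeJong1996ModelExtensionReduction.{u})
    (h₃ : DeJong1996PreSemiStablePairToSemiStablePair.{u})
    (hres : DeJong1996SemiStablePairResolution.{u}) : DeJong1996StrongAlgClosed.{u} :=
  DeJong1996StrongAlgClosed.of_sevenBlocks h₀ h14 hS h₁
    (DeJong1996StableModelToPreSemiStablePair.of_extensionReduction h₂) h₃ hres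

/-- Thm. 4.1 (i)+(ii) over every field from 4.5 (`DeJong1996Descent`) and the seven live nodes
with 4.22a proved. [cite: DeJong1996, 4.3–4.28, pp. 66–76] -/
theorem DeJong1996Strong.of_descent_of_sevenBlocks' (h45 : DeJong1996Descent.{u})
    (h₀ : DeJong1996FibrationReduction.{u}) (h14 : DeJong1996MultisectionReduction.{u})
    (hS : DeJong1996SectionsReduction.{u}) (h₁ : DeJong1996StableModelReduction.{u})
    (h₂ : DeJong1996ModelExtensionReduction.{u})
    (h₃ : DeJong1996PreSemiStablePairToSemiStablePair.{u})
    (hres : DeJong1996SemiStablePairResolution.{u}) : DeJong1996Strong.{u} :=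
  DeJong1996Strong.of_descent_of_sevenBlocks h45 h₀ h14 hS h₁
    (DeJong1996StableModelToPreSemiStablePair.of_extensionReduction h₂) h₃ hres

/-- Sanity of the cut: `DeJong1996ModelExtensionReduction` is a special case of Thm. 4.1 over
algebraically closed fields (a fibred pair is a pair as in Thm. 4.1). [folklore] -/
theorem DeJong1996ModelExtensionReduction.of_strongAlgClosed (H : DeJong1996StrongAlgClosed.{u}) :
    DeJong1996ModelExtensionReduction.{u} :=
  fun _ _ _ _ _ _ _ _ _ _ hP _ _ _ => hP.conclusionGenericallyEtale_of_strongAlgClosed H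

end Literature.AlgebraicGeometry.Resolution

end
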